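import Literature.Probability.Percolation.InterfaceScalingLimit
import Literature.Probability.LatticeModels.MedialExplorationChains
import Literature.Probability.RandomPlanarGeometry.CurveTortuosity
import Literature.Probability.RandomPlanarGeometry.CurveTightness
import HarnessLib

/-!
# Tightness of the critical bond-percolation interface on `δℤ²`: reduction to one percolation estimate

Trunk `Stoch`/`StatMech` (topic `Probability/Percolation`). This file reduces the tightness
statement **crit-perc.S26** for the medial exploration interface of critical bond percolation on
`δℤ²` in a Dobrushin domain,
`Literature.Probability.Percolation.isTightLaws_map_bondInterface` (`InterfaceScalingLimit.lean`), to a single named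
percolation-side fact, via the abstract Aizenman–Burchard criterion
`Literature.Probability.RandomPlanarGeometry.isTightMeasureSet_of_traversalBounds` (`CurveTightness.lean`, AB99 Thms 1.1–1.2):

* `bondExploration_shortDistanceCutoff` (C0, lattice geometry, AB99 §1.a "short-distance
  cutoff"): at mesh `δ ∈ (0, 1]` the exploration polygon stays in a fixed disc and never
  traverses a shell of inner radius `≤ δ` more than a fixed number `k₀` of times.
  **Proved** (`bondExploration_shortDistanceCutoff_holds`): the times the polygon spends in a
  ball of radius `≤ δ` form boundedly many intervals, because no medial dart is repeated and
  only boundedly many darts live near the ball (`not_hasTraversals_polyline_of_isMedialExploration`).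
* `bondExploration_traversalBound` (C1, the percolation estimate, AB99 hypothesis H1 / App. A
  with a boundary-dependent threshold): for admissible discretisations of small mesh
  `δ ≤ δ₀(D)`, `P_{1/2}(γ_δ traverses D(x; ρ, R) k(x, ρ, R) times) ≤ K (ρ/R)^λ`, `λ > 2`, for
  `δ ≤ ρ < R ≤ 1`. **Named fact** here (Russo–Seymour–Welsh, van den Berg–Kesten, and the boundary
  bookkeeping described in its docstring); **proved** downstream in `InterfaceTraversalBound.lean`
  (`bondExploration_traversalBound_holds`, whence `isTightLaws_map_bondInterface_holds`).
* `isTightMeasureSet_map_bondInterface_of_le` (Clarge): the interface laws with mesh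
  `δ ∈ [δ₀, 1]` form a tight family, for every `δ₀ > 0`. **Proved**
  (`isTightMeasureSet_map_bondInterface_of_le_holds`): at mesh `≥ δ₀` no polygon traverses any
  shell more than a fixed number of times, so the criterion applies with empty (H1)-events.

The assembly `isTightLaws_map_bondInterface_of_traversalBounds` (from C0, C1, Clarge) and its
corollary `isTightLaws_map_bondInterface_of_traversalBound` (from C1 alone) are proved here.

## Why the threshold in C1 depends on the shell (statement concern recorded for S26)

AB99's hypothesis H1 asks for `Prob(D(x; r, R) is traversed k times) ≤ K_k (r/R)^{λ(k)}`
*uniformly in the centre and the radii*. For the exploration path in a general Jordan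
Dobrushin domain this uniform form is **false** near the marked points `a`, `b`: there the two
boundary arcs (carrying the wired, resp. dual-wired, boundary condition) may oscillate across
shells `D(a; r, R)` at all scales, and the path, confined between them, is then *forced* to
traverse such shells many times with probability one. What the Russo–Seymour–Welsh/BK
technology gives is the bound for the traversals *in excess of* those forced by the (fixed,
continuous) boundary arcs, whose number in any given shell is finite; hence the deterministic,
`δ`-independent threshold `k x ρ R` in `bondExploration_traversalBound`. The abstract criterion
was proved for exactly this form (the threshold enters AB99's argument only through per-ball
counts), so tightness for *every* Jordan Dobrushin domain still follows. The docstring of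
`isTightLaws_map_bondInterface` ("H1 holds for critical percolation by RSW and BK (AB99 §1 and
Appendix)") should be read with this proviso; the statement itself is unaffected.

## References

* M. Aizenman, A. Burchard, *Hölder regularity and dimension bounds for random curves*, Duke
  Math. J. 99 (1999) 419–453, Thms 1.1–1.2, Lemma 3.1, §1.a, Appendix A (Thm A.1: H1 for 2D
  percolation models from RSW [Russo 1978; Seymour–Welsh 1978] and van den Berg–Kesten 1985).
* F. Camia, C. M. Newman, *Critical percolation exploration path and SLE₆: a proof of
  convergence*, Probab. Theory Related Fields 139 (2007), §2 (tightness of exploration paths in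
  Jordan domains via [AB99]).
* S. Smirnov, *Critical percolation in the plane*, C. R. Acad. Sci. Paris 333 (2001), §2.
* G. Grimmett, *Percolation*, 2nd ed. (1999), §11.7 (RSW), §2.3 (BK inequality).
-/

noncomputable section

open MeasureTheory Filter Topology Metric Set
open scoped unitInterval ENNReal

namespace Literature.Probability.Percolation

section CritPerc

open LatticeModels

/-! ### The exploration polygon as a parametrised curve -/

/-- The medial exploration polygon of the bond configuration `ω` on `δℤ²` in the Dobrushin
domain `D` (G02's `medialExplorationCurve (dobrushinData D δ) ω`, junk constant `0` when the
exploration path is not uniquely defined), as a `Curve ℂ` — i.e. before re-orientation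
(`orientCurve`) and before passing to the quotient `CurveClass ℂ` (`bondInterface`).
(Smirnov 2001, §2.) [cite: Smirnov2001, §2] -/
def bondExplorationCurve (D : RandomPlanarGeometry.DobrushinDomain) (δ : ℝ) (ω : BondConfig (Site 2)) : RandomPlanarGeometry.Curve ℂ :=
  ⟨medialExplorationCurve (dobrushinData D δ) ω⟩

/-- The re-oriented interface is the exploration curve or its time reversal.
(Camia–Newman 2007, §2.) [cite: CamiaNewman2007, §2] -/
theorem orientCurve_eq_or_reverse (D : RandomPlanarGeometry.DobrushinDomain) (γ : C(I, ℂ)) :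
    orientCurve D γ = (⟨γ⟩ : RandomPlanarGeometry.Curve ℂ) ∨ orientCurve D γ = (⟨γ⟩ : RandomPlanarGeometry.Curve ℂ).reverse :=
  orientCurve_eq_or D γ

/-- Re-orientation does not change the number of separate traversals of a shell.
(Aizenman–Burchard 1999, §2.a.) [cite: AizenmanBurchardDuke1999, §2.a] -/
theorem hasTraversals_orientCurve_iff (D : RandomPlanarGeometry.DobrushinDomain) (γ : C(I, ℂ)) (k : ℕ) (x : ℂ)
    (r R : ℝ) :
    (orientCurve D γ).HasTraversals k x r R ↔ (⟨γ⟩ : RandomPlanarGeometry.Curve ℂ).HasTraversals k x r R := by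
  rcases orientCurve_eq_or_reverse D γ with h | h <;> rw [h]
  exact RandomPlanarGeometry.Curve.hasTraversals_reverse_iff

/-- Re-orientation does not change the trace (as a `Curve.range`).
(Aizenman–Burchard 1999, §2.a.) [cite: AizenmanBurchardDuke1999, §2.a] -/
theorem curveRange_orientCurve (D : RandomPlanarGeometry.DobrushinDomain) (γ : C(I, ℂ)) :
    (orientCurve D γ).range = (⟨γ⟩ : RandomPlanarGeometry.Curve ℂ).range := by
  rcases orientCurve_eq_or_reverse D γ with h | h <;> rw [h]
  exact RandomPlanarGeometry.Curve.range_reverse _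

/-- `bondInterface D δ` is the class of the re-oriented exploration curve (definitional).
(Smirnov 2001, §2.) [cite: Smirnov2001, §2] -/
theorem bondInterface_eq_comp (D : RandomPlanarGeometry.DobrushinDomain) (δ : ℝ) :
    bondInterface D δ =
      RandomPlanarGeometry.CurveClass.mk ∘ fun ω ↦ orientCurve D (medialExplorationCurve (dobrushinData D δ) ω) :=
  rfl

/-! ### The three percolation-side inputs (named facts) -/

/-- **(C0) Short-distance cutoff of the exploration polygon** (lattice geometry; the hypothesis
"(H0)" of `isTightMeasureSet_of_traversalBounds`). For every Dobrushin domain `D` there are a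
radius `r₀` and a number `k₀` such that for every mesh `δ ∈ (0, 1]` and *every* configuration
`ω`: the medial exploration polygon `bondExplorationCurve D δ ω` lies in the disc
`closedBall 0 r₀` (its vertices are midpoints of edges of inner faces of `Ω_δ ⊆ Ω`, a bounded
set, or it is the junk constant `0`), and no shell `D(x; ρ, R)` with inner radius `ρ ≤ δ`
(`0 < ρ < R`) is traversed by `k₀` separate segments of it (the polygon uses each medial edge at
most once, `IsMedialExploration.nodup`, its vertices lie on `(δ/2)ℤ²`, so boundedly many of its
straight pieces meet `closedBall x δ`, and along each piece at most two separate traversals can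
start or end). This is the "short-distance cutoff `δ`" of Aizenman–Burchard, Duke Math. J. 99
(1999), §1.a (curves realised as lattice polygons of step `≍ δ`), made quantitative.
[cite: AizenmanBurchardDuke1999, §1.a] -/
def bondExploration_shortDistanceCutoff : Prop :=
  ∀ D : RandomPlanarGeometry.DobrushinDomain, ∃ (r₀ : ℝ) (k₀ : ℕ), 0 ≤ r₀ ∧ ∀ δ ∈ Set.Ioc (0 : ℝ) 1,
    ∀ ω : BondConfig (Site 2), (bondExplorationCurve D δ ω).range ⊆ closedBall 0 r₀ ∧
      ∀ (x : ℂ) (ρ R : ℝ), 0 < ρ → ρ ≤ δ → ρ < R →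
        ¬ (bondExplorationCurve D δ ω).HasTraversals k₀ x ρ R

/-- **(C1) Power bound on multiple shell crossings by the exploration path** — hypothesis H1 of
Aizenman–Burchard, Duke Math. J. 99 (1999), eq. (1.3), for the medial exploration path of
critical bond percolation `P_{1/2}` on `δℤ²` in a Dobrushin domain, in the **H21 formulation with
a shell-dependent threshold and for small mesh only**: for every Dobrushin domain `D` there are a
threshold `k : ℂ → ℝ → ℝ → ℕ` (independent of the mesh), constants `K ≥ 0`, `λ > 2` and a mesh
bound `δ₀ > 0` such that for every mesh `δ ∈ (0, δ₀]` at which the discretisation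
`dobrushinData D δ` is admissible (`IsZdAdmissible`, so that the exploration path is the genuine
one) and all shells with `δ ≤ ρ < R ≤ 1`,
`P_{1/2}(D(x; ρ, R) is traversed by k(x, ρ, R) separate segments of γ_δ) ≤ K (ρ / R)^λ`.
Content (proved in `InterfaceTraversalBound.lean`, `bondExploration_traversalBound_holds`, by a
variant of the following sketch): the `k` traversing segments cut the shell into `k` sectors, each
of which contains a monochromatic (open, resp. dual-open) lattice crossing of the shell
`D(x; ρ + 2δ, R - 2δ)` running alongside the path (open edges on its left, dual-open edges on its
right, Smirnov 2001, §2); at least half of these crossings have the same type, and those made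
of interior edges of `Ω_δ` (whose states are those of the i.i.d. configuration) are `j` disjoint
crossings of probability `≤ (C (ρ/R)^{c})^j` by the Russo–Seymour–Welsh bound and the
van den Berg–Kesten inequality — this is AB99, Appendix A, Thm A.1 (H1, indeed with
`λ(k) → ∞`, for two-dimensional critical percolation models in the plane). The threshold
`k(x, ρ, R)` absorbs the sectors whose crossing is supplied by the frozen boundary arcs (arc `A`
open, arc `B` and the exterior dual-open): their number is bounded, uniformly in small `δ`, by
the number of excursions of the Jordan curve `∂D` across the half-shells of `D(x; ρ, R)`, which
is finite by uniform continuity (see the module docstring: with a constant threshold the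
statement would be false near the marked points of a general Jordan domain). This boundary
bookkeeping is the part of the statement that is not in print: AB99 state H1 for the full-plane
models, and Camia–Newman, PTRF 139 (2007), §2, invoke [AB99] for the tightness of exploration
paths in Jordan domains without further comment.
[cite: AizenmanBurchardDuke1999, §1.b (1.3) and Appendix A Thm A.1] [cite: CamiaNewman2007, §2] -/
def bondExploration_traversalBound : Prop :=
  ∀ D : RandomPlanarGeometry.DobrushinDomain, ∃ (k : ℂ → ℝ → ℝ → ℕ) (K lam δ₀ : ℝ), 0 ≤ K ∧ 2 < lam ∧ 0 < δ₀ ∧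
    ∀ δ ∈ Set.Ioc (0 : ℝ) δ₀, (dobrushinData D δ).IsZdAdmissible →
      ∀ (x : ℂ) (ρ R : ℝ), δ ≤ ρ → ρ < R → R ≤ 1 →
        bondPercolation (zdGraph 2) half
            {ω | (bondExplorationCurve D δ ω).HasTraversals (k x ρ R) x ρ R} ≤
          ENNReal.ofReal (K * (ρ / R) ^ lam)

/-- **(Clarge) Tightness away from `δ = 0`.** For every Dobrushin domain `D` and every
`δ₀ > 0`, the laws `(P_{1/2}).map (bondInterface D δ)`, `δ ∈ [δ₀, 1]`, form a tight set of
measures on `CurveClass ℂ`. Content (not formalised here): at mesh `δ ≥ δ₀` the exploration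
path is one of finitely many lists of medial vertices (medial edges of inner faces of the
bounded `Ω_δ`, none repeated), the same finite stock for all `δ ∈ [δ₀, 1]`; the class of the
polygon of a fixed list rescaled by `δ` depends continuously on `δ`, so all these laws are
carried by a fixed compact set — a finite union of continuous images of `[δ₀, 1]` (and their
time reversals). (Aizenman–Burchard 1999, §1.a: only the limit `δ → 0` is at stake; Billingsley,
*Convergence of probability measures*, 2nd ed., §1.5.) [cite: AizenmanBurchardDuke1999, §1.a] -/
def isTightMeasureSet_map_bondInterface_of_le : Prop :=
  ∀ (D : RandomPlanarGeometry.DobrushinDomain) (δ₀ : ℝ), 0 < δ₀ →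
    IsTightMeasureSet
      ((fun δ ↦ (bondPercolation (zdGraph 2) half).map (bondInterface D δ)) '' Set.Icc δ₀ 1)

/-! ### The assembly -/

/-- Eventual admissibility along `𝓝[>] 0` gives a threshold `δ₁ > 0` below which all meshes are
admissible. (Smirnov 2001, §2: proper discretisations for small mesh.) [cite: Smirnov2001, §2] -/
theorem exists_forall_isZdAdmissible_of_eventually {D : RandomPlanarGeometry.DobrushinDomain}
    (hD : ∀ᶠ δ in 𝓝[>] (0 : ℝ), (dobrushinData D δ).IsZdAdmissible) :
    ∃ δ₁ > 0, ∀ δ, 0 < δ → δ < δ₁ → (dobrushinData D δ).IsZdAdmissible := by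
  rw [eventually_nhdsWithin_iff, Metric.eventually_nhds_iff] at hD
  obtain ⟨ε, hε, h⟩ := hD
  refine ⟨ε, hε, fun δ hδ hδε ↦ h ?_ hδ⟩
  rwa [Real.dist_eq, sub_zero, abs_of_pos hδ]

/-- **Tightness of the bond interface near `δ = 0` from (C0) and (C1)**, by the
Aizenman–Burchard criterion `isTightMeasureSet_of_traversalBounds` applied in `E = ℂ` with
`Λ = closedBall 0 r₀` (covering exponent `d = 2`, `exists_finset_card_le_cover_closedBall`),
the random curves `X_δ = orientCurve D (medialExplorationCurve (dobrushinData D δ) ·)` (whose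
classes are `bondInterface D δ`, and whose traversal counts and traces are those of the
exploration polygon, `hasTraversals_orientCurve_iff`), the threshold `max k₀ (k x ρ R)` and the
index set `T = (0, δ₂]` of small admissible meshes (`δ₂ ≤ min δ₀ 1`).
(Aizenman–Burchard 1999, Thm 1.2.) [cite: AizenmanBurchardDuke1999, Thm 1.2] -/
theorem exists_isTightMeasureSet_map_bondInterface_of_traversalBounds
    (h0 : bondExploration_shortDistanceCutoff) (h1 : bondExploration_traversalBound)
    (D : RandomPlanarGeometry.DobrushinDomain) :
    ∃ δ₃ > 0, ∀ δ₂, δ₂ ≤ δ₃ → (∀ δ, 0 < δ → δ ≤ δ₂ → (dobrushinData D δ).IsZdAdmissible) →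
      IsTightMeasureSet
        ((fun δ ↦ (bondPercolation (zdGraph 2) half).map (bondInterface D δ)) '' Set.Ioc 0 δ₂) := by
  obtain ⟨r₀, k₀, hr₀, hcut⟩ := h0 D
  obtain ⟨k, K, lam, δ₀, hK, hlam, hδ₀, hbd⟩ := h1 D
  refine ⟨min δ₀ 1, lt_min hδ₀ one_pos, fun δ₂ hδ₂ hadm ↦ ?_⟩
  have hT : Set.Ioc 0 δ₂ ⊆ Set.Ioc (0 : ℝ) 1 :=
    Set.Ioc_subset_Ioc_right (hδ₂.trans (min_le_right _ _))
  have hT₀ : Set.Ioc 0 δ₂ ⊆ Set.Ioc (0 : ℝ) δ₀ :=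
    Set.Ioc_subset_Ioc_right (hδ₂.trans (min_le_left _ _))
  have key := RandomPlanarGeometry.isTightMeasureSet_of_traversalBounds (E := ℂ) (isCompact_closedBall (0 : ℂ) r₀)
    (C := 9 * (r₀ + 2) ^ 2) (d := 2) zero_le_two
    (fun ρ hρ hρ1 ↦ RandomPlanarGeometry.exists_finset_card_le_cover_closedBall hr₀ ρ hρ hρ1)
    (Ω := fun _ ↦ BondConfig (Site 2)) (fun _ ↦ bondPercolation (zdGraph 2) half)
    (fun δ ω ↦ orientCurve D (medialExplorationCurve (dobrushinData D δ) ω))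
    (fun x ρ R ↦ max k₀ (k x ρ R)) hK hlam hT ?_ ?_
  · simpa only [bondInterface_eq_comp] using key
  · -- (H0) from (C0), for every `ω`
    intro δ hδ
    refine ae_of_all _ fun ω ↦ ⟨?_, fun x ρ R hρ hρδ hρR htr ↦ ?_⟩
    · rw [curveRange_orientCurve]
      exact (hcut δ (hT hδ) ω).1
    · rw [hasTraversals_orientCurve_iff] at htr
      exact (hcut δ (hT hδ) ω).2 x ρ R hρ hρδ hρR (htr.of_le (le_max_left _ _))
  · -- (H1) from (C1)
    intro δ hδ x ρ R hδρ hρR hR1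
    refine le_trans (measure_mono fun ω hω ↦ ?_)
      (hbd δ (hT₀ hδ) (hadm δ hδ.1 hδ.2) x ρ R hδρ hρR hR1)
    simp only [mem_setOf_eq, hasTraversals_orientCurve_iff] at hω ⊢
    exact hω.of_le (le_max_right _ _)

/-- **Assembly: crit-perc.S26 for bond percolation from (C0), (C1), (Clarge).** The interface
laws for `δ ∈ (0, 1]` split into `δ ∈ (0, δ₂]`, where the discretisations are admissible
(eventual admissibility is the hypothesis of `isTightLaws_map_bondInterface`), the meshes are
small and `exists_isTightMeasureSet_map_bondInterface_of_traversalBounds` applies, and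
`δ ∈ [δ₂, 1]`, covered by (Clarge); a union of two tight sets is tight. (Aizenman–Burchard 1999,
Thm 1.2, bond-`ℤ²` case, single-interface half of S26.) [cite: AizenmanBurchardDuke1999, Thm 1.2] -/
theorem isTightLaws_map_bondInterface_of_traversalBounds
    (h0 : bondExploration_shortDistanceCutoff) (h1 : bondExploration_traversalBound)
    (hL : isTightMeasureSet_map_bondInterface_of_le) : isTightLaws_map_bondInterface := by
  intro D hD
  obtain ⟨δ₁, hδ₁, hadm⟩ := exists_forall_isZdAdmissible_of_eventually hD
  obtain ⟨δ₃, hδ₃, hsmall⟩ := exists_isTightMeasureSet_map_bondInterface_of_traversalBounds h0 h1 D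
  set δ₂ : ℝ := min (δ₁ / 2) δ₃ with hδ₂
  have hδ₂pos : 0 < δ₂ := lt_min (by positivity) hδ₃
  have hδ₂lt : δ₂ < δ₁ := (min_le_left _ _).trans_lt (by linarith)
  have hsmall' := hsmall δ₂ (min_le_right _ _) fun δ hδ hδle ↦ hadm δ hδ (hδle.trans_lt hδ₂lt)
  have hlarge := hL D δ₂ hδ₂pos
  refine (hsmall'.union hlarge).subset ?_
  rw [← Set.image_union]
  refine Set.image_mono fun δ hδ ↦ ?_
  rcases le_or_gt δ δ₂ with h | h
  · exact Or.inl ⟨hδ.1, h⟩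
  · exact Or.inr ⟨h.le, hδ.2⟩

/-! ### Towards (C0) and (Clarge): order-connected covers of the times a polyline spends in a convex set -/

section PolylineGeometry

variable {V : Type*} [NormedAddCommGroup V] [NormedSpace ℝ V]

/-- A set of times `U ⊆ [0, 1]` is covered by at most `m` order-connected subsets of itself.
(Bookkeeping notion for the short-distance cutoff, AB99 §1.a.) [cite: AizenmanBurchardDuke1999, §1.a] -/
def HasOrdConnectedCover (U : Set I) (m : ℕ) : Prop :=
  ∃ F : Finset (Set I), F.card ≤ m ∧ (∀ W ∈ F, W.OrdConnected ∧ W ⊆ U) ∧ U ⊆ ⋃ W ∈ F, W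

/-- Monotonicity of `HasOrdConnectedCover` in the number of pieces. [cite: AizenmanBurchardDuke1999, §1.a] -/
theorem HasOrdConnectedCover.mono {U : Set I} {m m' : ℕ} (h : HasOrdConnectedCover U m)
    (hm : m ≤ m') : HasOrdConnectedCover U m' := by
  obtain ⟨F, hF, h1, h2⟩ := h
  exact ⟨F, hF.trans hm, h1, h2⟩

/-- An order-connected set is covered by one order-connected piece. [cite: AizenmanBurchardDuke1999, §1.a] -/
theorem hasOrdConnectedCover_one {U : Set I} (hU : U.OrdConnected) : HasOrdConnectedCover U 1 := by
  classical
  refine ⟨{U}, by simp, by simp [hU], by simp⟩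

/-- Covers of two sets give a cover of their union. [cite: AizenmanBurchardDuke1999, §1.a] -/
theorem HasOrdConnectedCover.union {U₁ U₂ : Set I} {m₁ m₂ : ℕ} (h₁ : HasOrdConnectedCover U₁ m₁)
    (h₂ : HasOrdConnectedCover U₂ m₂) : HasOrdConnectedCover (U₁ ∪ U₂) (m₁ + m₂) := by
  classical
  obtain ⟨F₁, hF₁, h₁W, h₁U⟩ := h₁
  obtain ⟨F₂, hF₂, h₂W, h₂U⟩ := h₂
  refine ⟨F₁ ∪ F₂, (Finset.card_union_le _ _).trans (add_le_add hF₁ hF₂), fun W hW ↦ ?_, ?_⟩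
  · rcases Finset.mem_union.1 hW with hW | hW
    · exact ⟨(h₁W W hW).1, (h₁W W hW).2.trans subset_union_left⟩
    · exact ⟨(h₂W W hW).1, (h₂W W hW).2.trans subset_union_right⟩
  · refine union_subset (h₁U.trans ?_) (h₂U.trans ?_) <;>
      refine iUnion₂_subset fun W hW ↦ ?_
    · exact subset_iUnion₂ (s := fun W (_ : W ∈ F₁ ∪ F₂) ↦ W) W (Finset.mem_union_left _ hW)
    · exact subset_iUnion₂ (s := fun W (_ : W ∈ F₁ ∪ F₂) ↦ W) W (Finset.mem_union_right _ hW)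

/-- Covers are transported by maps preserving order-connectedness. [cite: AizenmanBurchardDuke1999, §1.a] -/
theorem HasOrdConnectedCover.image {U : Set I} {m : ℕ} (h : HasOrdConnectedCover U m) (e : I → I)
    (he : ∀ S : Set I, S.OrdConnected → (e '' S).OrdConnected) :
    HasOrdConnectedCover (e '' U) m := by
  classical
  obtain ⟨F, hF, hW, hU⟩ := h
  refine ⟨F.image (Set.image e), Finset.card_image_le.trans hF, fun W hW' ↦ ?_, ?_⟩
  · obtain ⟨S, hS, rfl⟩ := Finset.mem_image.1 hW'
    exact ⟨he S (hW S hS).1, image_mono (hW S hS).2⟩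
  · rintro _ ⟨t, ht, rfl⟩
    obtain ⟨S, hS, htS⟩ : ∃ S ∈ F, t ∈ S := by simpa only [mem_iUnion, exists_prop] using hU ht
    refine mem_iUnion₂.2 ⟨e '' S, Finset.mem_image_of_mem _ hS, mem_image_of_mem e htS⟩

/-- The first-half time change `s ↦ s / 2` of `Path.trans`. [folklore] -/
def halfL (s : I) : I :=
  ⟨(s : ℝ) / 2, unitInterval.div_mem s.2.1 zero_le_two (s.2.2.trans one_le_two)⟩

/-- The second-half time change `s ↦ (s + 1) / 2` of `Path.trans`. [folklore] -/
def halfR (s : I) : I :=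
  ⟨((s : ℝ) + 1) / 2, by
    constructor
    · linarith [s.2.1]
    · linarith [s.2.2]⟩

/-- `halfL` in coordinates. [folklore] -/
@[simp] theorem coe_halfL (s : I) : (halfL s : ℝ) = s / 2 := rfl

/-- `halfR` in coordinates. [folklore] -/
@[simp] theorem coe_halfR (s : I) : (halfR s : ℝ) = (s + 1) / 2 := rfl

/-- Images of order-connected sets under `halfL` are order-connected. [folklore] -/
theorem ordConnected_image_halfL {S : Set I} (hS : S.OrdConnected) : (halfL '' S).OrdConnected := by
  refine ⟨?_⟩
  rintro _ ⟨a, ha, rfl⟩ _ ⟨b, hb, rfl⟩ y ⟨hay, hyb⟩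
  have hy1 : 2 * (y : ℝ) ≤ 1 := by
    have : (y : ℝ) ≤ b / 2 := hyb
    linarith [b.2.2]
  refine ⟨⟨2 * y, ⟨by linarith [y.2.1], hy1⟩⟩, hS.out ha hb ⟨?_, ?_⟩, Subtype.ext (by simp)⟩
  · change (a : ℝ) ≤ 2 * y
    have : (a : ℝ) / 2 ≤ y := hay
    linarith
  · change 2 * (y : ℝ) ≤ b
    have : (y : ℝ) ≤ b / 2 := hyb
    linarith

/-- Images of order-connected sets under `halfR` are order-connected. [folklore] -/
theorem ordConnected_image_halfR {S : Set I} (hS : S.OrdConnected) : (halfR '' S).OrdConnected := by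
  refine ⟨?_⟩
  rintro _ ⟨a, ha, rfl⟩ _ ⟨b, hb, rfl⟩ y ⟨hay, hyb⟩
  have hay' : ((a : ℝ) + 1) / 2 ≤ y := hay
  have hyb' : (y : ℝ) ≤ (b + 1) / 2 := hyb
  refine ⟨⟨2 * y - 1, ⟨by linarith [a.2.1], by linarith [b.2.2]⟩⟩, hS.out ha hb ⟨?_, ?_⟩,
    Subtype.ext (show (2 * (y : ℝ) - 1 + 1) / 2 = y by ring)⟩
  · change (a : ℝ) ≤ 2 * y - 1
    linarith
  · change 2 * (y : ℝ) - 1 ≤ b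
    linarith

/-- The times a concatenated path spends in a set, in terms of its two halves. [folklore] -/
theorem preimage_trans_eq {X : Type*} [TopologicalSpace X] {x y z : X} (γ : Path x y)
    (γ' : Path y z) (C : Set X) :
    (γ.trans γ') ⁻¹' C = halfL '' (γ ⁻¹' C) ∪ halfR '' (γ' ⁻¹' C) := by
  ext t
  constructor
  · intro ht
    rw [mem_preimage, Path.trans_apply] at ht
    split_ifs at ht with h
    · refine Or.inl ⟨_, ht, Subtype.ext ?_⟩
      simp
    · refine Or.inr ⟨_, ht, Subtype.ext ?_⟩
      simp only [coe_halfR]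
      ring
  · rintro (⟨s, hs, rfl⟩ | ⟨s, hs, rfl⟩)
    · rw [mem_preimage, Path.trans_apply,
        dif_pos (show ((halfL s : I) : ℝ) ≤ 1 / 2 by simp only [coe_halfL]; linarith [s.2.2])]
      have : (⟨2 * ((halfL s : I) : ℝ), (unitInterval.mul_pos_mem_iff zero_lt_two).2
          ⟨(halfL s).2.1, show ((halfL s : I) : ℝ) ≤ 1 / 2 by
            simp only [coe_halfL]; linarith [s.2.2]⟩⟩ : I) = s :=
        Subtype.ext (show 2 * ((s : ℝ) / 2) = s by ring)
      rw [this]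
      exact hs
    · rw [mem_preimage, Path.trans_apply]
      split_ifs with h
      · -- `s = 0`, and both paths pass through `y` at the junction
        have hs0 : (s : ℝ) = 0 := by
          have : ((s : ℝ) + 1) / 2 ≤ 1 / 2 := h
          linarith [s.2.1]
        have h1 : (⟨2 * ((halfR s : I) : ℝ), (unitInterval.mul_pos_mem_iff zero_lt_two).2
            ⟨(halfR s).2.1, h⟩⟩ : I) = 1 := Subtype.ext (by simp [hs0])
        have h0 : s = 0 := Subtype.ext hs0
        rw [h1, γ.target]
        rw [h0] at hs
        simpa using hs
      · have : (⟨2 * ((halfR s : I) : ℝ) - 1, unitInterval.two_mul_sub_one_mem_iff.2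
            ⟨(not_le.1 h).le, (halfR s).2.2⟩⟩ : I) = s :=
          Subtype.ext (show 2 * (((s : ℝ) + 1) / 2) - 1 = s by ring)
        rw [this]
        exact hs

/-- The preimage of a convex set under a straight segment path is order-connected. [folklore] -/
theorem ordConnected_preimage_segment {C : Set V} (hC : Convex ℝ C) (a b : V) :
    ((Path.segment a b) ⁻¹' C).OrdConnected := by
  refine ⟨fun s hs t ht u hu ↦ ?_⟩
  simp only [mem_preimage, Path.segment_apply] at hs ht ⊢
  have hsu : (s : ℝ) ≤ u := hu.1
  have hut : (u : ℝ) ≤ t := hu.2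
  -- `lineMap a b u` lies on the segment from `lineMap a b s` to `lineMap a b t`
  have hmem : AffineMap.lineMap a b (u : ℝ) ∈ segment ℝ (AffineMap.lineMap a b (s : ℝ))
      (AffineMap.lineMap a b (t : ℝ)) := by
    rcases eq_or_lt_of_le (hsu.trans hut) with hst | hst
    · have hsu' : (s : ℝ) = u := le_antisymm hsu (hst ▸ hut)
      rw [← hsu']
      exact left_mem_segment _ _ _
    · refine ⟨((t : ℝ) - u) / ((t : ℝ) - s), ((u : ℝ) - s) / ((t : ℝ) - s),
        div_nonneg (by linarith) (by linarith), div_nonneg (by linarith) (by linarith), ?_, ?_⟩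
      · field_simp; ring
      · simp only [AffineMap.lineMap_apply_module]
        have hts : (t : ℝ) - s ≠ 0 := by linarith
        -- compare coefficients of `a` and `b`
        have e1 : ((t : ℝ) - u) / ((t : ℝ) - s) * (1 - (s : ℝ)) + ((u : ℝ) - s) / ((t : ℝ) - s) * (1 - (t : ℝ)) = 1 - u := by
          field_simp; ring
        have e2 : ((t : ℝ) - u) / ((t : ℝ) - s) * (s : ℝ) + ((u : ℝ) - s) / ((t : ℝ) - s) * (t : ℝ) = u := by
          field_simp; ring
        have hsplit : (((t : ℝ) - u) / ((t : ℝ) - s)) • ((1 - (s : ℝ)) • a + (s : ℝ) • b) +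
            (((u : ℝ) - s) / ((t : ℝ) - s)) • ((1 - (t : ℝ)) • a + (t : ℝ) • b) =
            (((t : ℝ) - u) / ((t : ℝ) - s) * (1 - (s : ℝ)) + ((u : ℝ) - s) / ((t : ℝ) - s) * (1 - (t : ℝ))) • a +
            (((t : ℝ) - u) / ((t : ℝ) - s) * (s : ℝ) + ((u : ℝ) - s) / ((t : ℝ) - s) * (t : ℝ)) • b := by
          simp only [smul_add, smul_smul, add_smul]
          abel
        rw [hsplit, e1, e2]
  exact hC.segment_subset hs ht hmem

open Classical in
/-- The number of segments of the polyline from `a` through the points of `l`, in order, that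
meet the set `C`. (Counting device for the short-distance cutoff, AB99 §1.a.) [cite: AizenmanBurchardDuke1999, §1.a] -/
def segMeetCount (C : Set V) : V → List V → ℕ
  | _, [] => 0
  | a, b :: l => (if (segment ℝ a b ∩ C).Nonempty then 1 else 0) + segMeetCount C b l

/-- **The times a polyline spends in a convex set** are covered by at most (number of segments
meeting the set) `+ 1` order-connected pieces: one interval per segment meeting the set
(the preimage of a convex set under an affine segment is an interval), plus possibly the
constant tail of the dyadic parametrisation. [folklore] -/
theorem hasOrdConnectedCover_preimage_polylineFrom {C : Set V} (hC : Convex ℝ C) (a : V)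
    (l : List V) :
    HasOrdConnectedCover ((polylineFrom a l).2 ⁻¹' C) (segMeetCount C a l + 1) := by
  classical
  induction l generalizing a with
  | nil =>
    refine hasOrdConnectedCover_one ⟨fun s hs t _ u _ ↦ ?_⟩
    change (Path.refl a) u ∈ C
    have hs' : (Path.refl a) s ∈ C := hs
    simpa using hs'
  | cons b l ih =>
    change HasOrdConnectedCover (((Path.segment a b).trans (polylineFrom b l).2) ⁻¹' C)
      ((if (segment ℝ a b ∩ C).Nonempty then 1 else 0) + segMeetCount C b l + 1)
    rw [preimage_trans_eq, add_assoc]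
    refine HasOrdConnectedCover.union ?_ ((ih b).image halfR fun S ↦ ordConnected_image_halfR)
    split_ifs with hmeet
    · exact (hasOrdConnectedCover_one (ordConnected_preimage_segment hC a b)).image halfL
        fun S ↦ ordConnected_image_halfL
    · -- the segment misses `C`: nothing to cover
      have hempty : (Path.segment a b) ⁻¹' C = ∅ := by
        refine eq_empty_of_forall_notMem fun t ht ↦ hmeet ⟨_, ?_, ht⟩
        rw [← Path.range_segment]
        exact mem_range_self t
      refine ⟨∅, by simp, by simp, ?_⟩
      simp [hempty]

/-- The range of a polyline through points of a convex set lies in that set. [folklore] -/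
theorem range_polylineFrom_subset {C : Set V} (hC : Convex ℝ C) {a : V} {l : List V} (ha : a ∈ C)
    (hl : ∀ p ∈ l, p ∈ C) : Set.range (polylineFrom a l).2 ⊆ C := by
  induction l generalizing a with
  | nil =>
    rintro _ ⟨t, rfl⟩
    change (Path.refl a) t ∈ C
    simpa using ha
  | cons b l ih =>
    change Set.range ((Path.segment a b).trans (polylineFrom b l).2) ⊆ C
    rw [Path.trans_range, Path.range_segment]
    exact union_subset (hC.segment_subset ha (hl b (by simp)))
      (ih (hl b (by simp)) fun p hp ↦ hl p (by simp [hp]))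

/-- Counting the segments meeting `C` through an injective labelling: if the consecutive pairs
of `a :: l` are pairwise distinct and every pair whose (image) segment meets `C` lies in the
finite set `S`, then at most `#S` segments of the image polyline meet `C`. [folklore] -/
theorem segMeetCount_map_le_card {α : Type*} [DecidableEq α] (C : Set V) (φ : α → V) (a : α)
    (l : List α) (S : Finset (α × α)) (hnd : ((a :: l).zip l).Nodup)
    (hS : ∀ pq ∈ (a :: l).zip l, (segment ℝ (φ pq.1) (φ pq.2) ∩ C).Nonempty → pq ∈ S) :
    segMeetCount C (φ a) (l.map φ) ≤ S.card := by
  classical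
  induction l generalizing a S with
  | nil => exact Nat.zero_le _
  | cons b l ih =>
    rw [List.zip_cons_cons, List.nodup_cons] at hnd
    change (if (segment ℝ (φ a) (φ b) ∩ C).Nonempty then 1 else 0) + segMeetCount C (φ b) (l.map φ)
      ≤ S.card
    have hmem : ∀ pq ∈ (b :: l).zip l, pq ∈ (a :: b :: l).zip (b :: l) := fun pq hpq ↦ by
      rw [List.zip_cons_cons]
      exact List.mem_cons_of_mem _ hpq
    split_ifs with hmeet
    · have hab : (a, b) ∈ S := hS (a, b) (by simp) hmeet
      have hih := ih b (S.erase (a, b)) hnd.2 fun pq hpq hpqC ↦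
        Finset.mem_erase.2 ⟨fun h ↦ hnd.1 (h ▸ hpq), hS pq (hmem pq hpq) hpqC⟩
      rw [Finset.card_erase_of_mem hab] at hih
      have := Finset.card_pos.2 ⟨_, hab⟩
      omega
    · simpa using ih b S hnd.2 fun pq hpq hpqC ↦ hS pq (hmem pq hpq) hpqC

end PolylineGeometry

/-! ### Separate traversals versus order-connected covers -/

section TraversalCount

variable {V : Type*} [PseudoMetricSpace V]

/-- **Few intervals in the small ball, few separate traversals.** If the set of times that the
curve `γ` spends in the closed ball `B̄(x, ρ)` is covered by at most `m` order-connected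
pieces and `ρ < R`, then the shell `D(x; ρ, R)` is traversed by at most `2m` separate segments
of `γ`: recording for each traversal the piece containing its endpoint in `B̄(x, ρ)` and its
direction (inward/outward) is injective, since two traversals of the same direction attached
to the same piece would force the far endpoint of one of them into `B̄(x, ρ)`.
(The lattice "short-distance cutoff" of AB99 §1.a, made quantitative.) [cite: AizenmanBurchardDuke1999, §1.a] -/
theorem le_of_hasTraversals_of_hasOrdConnectedCover {γ : RandomPlanarGeometry.Curve V} {x : V} {ρ R : ℝ} {m k : ℕ}
    (hρR : ρ < R) (hcov : HasOrdConnectedCover (γ ⁻¹' closedBall x ρ) m)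
    (hk : γ.HasTraversals k x ρ R) : k ≤ 2 * m := by
  classical
  obtain ⟨F, hFcard, hFW, hFU⟩ := hcov
  obtain ⟨s, t, hst, hsep⟩ := hk
  -- the endpoint in the small ball and the direction of each traversal
  have hdir : ∀ i, (dist (γ (s i)) x ≤ ρ ∧ R ≤ dist (γ (t i)) x) ∨
      (R ≤ dist (γ (s i)) x ∧ dist (γ (t i)) x ≤ ρ) := fun i ↦ (hst i).2
  let out : Fin k → Bool := fun i ↦ decide (dist (γ (s i)) x ≤ ρ)
  let u : Fin k → I := fun i ↦ if dist (γ (s i)) x ≤ ρ then s i else t i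
  have hu : ∀ i, u i ∈ γ ⁻¹' closedBall x ρ := by
    intro i
    simp only [u, mem_preimage, mem_closedBall]
    split_ifs with h
    · exact h
    · rcases hdir i with h' | h'
      · exact absurd h'.1 h
      · exact h'.2
  have hW : ∀ i, ∃ W ∈ F, u i ∈ W := fun i ↦ by
    simpa only [mem_iUnion, exists_prop] using hFU (hu i)
  choose W hWF hWu using hW
  -- the labelling
  let Φ : Fin k → F × Bool := fun i ↦ (⟨W i, hWF i⟩, out i)
  have key : ∀ i j, i < j → Φ i ≠ Φ j := by
    intro i j hij heq
    simp only [Φ, Prod.mk.injEq, Subtype.mk.injEq] at heq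
    obtain ⟨hWij, hout⟩ := heq
    have hWoc := (hFW _ (hWF i)).1
    have hWsub := (hFW _ (hWF i)).2
    have htisj : t i < s j := hsep hij
    by_cases hi : dist (γ (s i)) x ≤ ρ
    · -- both outward: `t i` lies between `s i = u i` and `s j = u j`
      have hj : dist (γ (s j)) x ≤ ρ := by simpa [out, hi] using hout.symm
      have hui : u i = s i := by simp [u, hi]
      have huj : u j = s j := by simp [u, hj]
      have hmem : t i ∈ W i := hWoc.out (hWu i) (hWij ▸ hWu j)
        ⟨by rw [hui]; exact (hst i).1, by rw [huj]; exact htisj.le⟩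
      have h1 : dist (γ (t i)) x ≤ ρ := by simpa using hWsub hmem
      rcases hdir i with h' | h' <;> linarith [h'.2, h'.1]
    · -- both inward: `s j` lies between `t i = u i` and `t j = u j`
      have hj : ¬ dist (γ (s j)) x ≤ ρ := by simpa [out, hi] using hout.symm
      have hui : u i = t i := by simp [u, hi]
      have huj : u j = t j := by simp [u, hj]
      have hmem : s j ∈ W i := hWoc.out (hWu i) (hWij ▸ hWu j)
        ⟨by rw [hui]; exact htisj.le, by rw [huj]; exact (hst j).1⟩
      exact hj (by simpa using hWsub hmem)
  have hinj : Function.Injective Φ := by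
    intro i j h
    by_contra hne
    rcases lt_or_gt_of_ne hne with hlt | hlt
    · exact key i j hlt h
    · exact key j i hlt h.symm
  have := Fintype.card_le_of_injective Φ hinj
  simp only [Fintype.card_fin, Fintype.card_prod, Fintype.card_coe, Fintype.card_bool] at this
  calc k ≤ F.card * 2 := this
    _ ≤ m * 2 := Nat.mul_le_mul_right 2 hFcard
    _ = 2 * m := Nat.mul_comm _ _

end TraversalCount

/-! ### Counting the darts near a ball -/

section MedialGeometry

/-- The medial darts carried by corners `(v, f)` whose primal vertex `v` lies in the box of
half-width `n` about the site `c` (a finite set of size `≤ 4 (2n + 1)²`). [folklore] -/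
def dartBox (c : Site 2) (n : ℕ) : Finset (MedialVertex × MedialVertex) :=
  ((Finset.Icc (c 0 - n) (c 0 + n) ×ˢ Finset.Icc (c 1 - n) (c 1 + n)) ×ˢ
    (({0, 1} : Finset ℤ) ×ˢ ({0, 1} : Finset ℤ))).image
    fun q ↦ (cornerSource ![q.1.1, q.1.2] ![q.1.1 - q.2.1, q.1.2 - q.2.2],
      cornerTarget ![q.1.1, q.1.2] ![q.1.1 - q.2.1, q.1.2 - q.2.2])

/-- The dart box has at most `4 (2n + 1)²` elements. [folklore] -/
theorem card_dartBox_le (c : Site 2) (n : ℕ) : (dartBox c n).card ≤ (2 * n + 1) ^ 2 * 4 := by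
  refine Finset.card_image_le.trans ?_
  have h0 : (c 0 + n + 1 - (c 0 - n)).toNat = 2 * n + 1 := by omega
  have h1 : (c 1 + n + 1 - (c 1 - n)).toNat = 2 * n + 1 := by omega
  rw [Finset.card_product, Finset.card_product, Finset.card_product, Int.card_Icc, Int.card_Icc,
    h0, h1, Finset.card_pair (by norm_num)]
  exact le_of_eq (by ring)

/-- Darts carried by corners in the box belong to the dart box. [folklore] -/
theorem mem_dartBox {c : Site 2} {n : ℕ} {v f : Site 2} (hv : IsCorner v f)
    (hbox : ∀ i, |v i - c i| ≤ n) : (cornerSource v f, cornerTarget v f) ∈ dartBox c n := by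
  rw [dartBox, Finset.mem_image]
  refine ⟨((v 0, v 1), (v 0 - f 0, v 1 - f 1)), ?_, ?_⟩
  · have h0 := abs_le.1 (hbox 0)
    have h1 := abs_le.1 (hbox 1)
    have hv0 := hv 0
    have hv1 := hv 1
    simp only [Finset.mem_product, Finset.mem_Icc, Finset.mem_insert, Finset.mem_singleton]
    refine ⟨⟨⟨?_, ?_⟩, ?_, ?_⟩, ?_, ?_⟩ <;> omega
  · have hv' : (![v 0, v 1] : Site 2) = v := by
      ext j; fin_cases j <;> rfl
    have hf' : (![v 0 - (v 0 - f 0), v 1 - (v 1 - f 1)] : Site 2) = f := by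
      ext j; fin_cases j <;> simp
    simp only [hv', hf']

/-- A site whose mesh point is within `K δ` of `x` is within `K + 1` lattice units
(coordinatewise) of the site nearest to `x`. [folklore] -/
theorem abs_sub_nearestSite_le {δ : ℝ} (hδ : 0 < δ) {v : Site 2} {x : ℂ} {K : ℝ} {n : ℕ}
    (h : dist (meshPoint δ v) x ≤ K * δ) (hK : K + 1 ≤ n) (i : Fin 2) :
    |v i - nearestSite δ x i| ≤ n := by
  have hc := dist_meshPoint_nearestSite_le hδ x
  have hvc : dist (meshPoint δ v) (meshPoint δ (nearestSite δ x)) ≤ (K + 1) * δ :=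
    (dist_triangle_right _ _ x).trans (by linarith)
  rw [Complex.dist_eq] at hvc
  have hcoord : δ * |(v i : ℝ) - (nearestSite δ x i : ℝ)| ≤ (K + 1) * δ := by
    fin_cases i
    · refine le_trans ?_ ((Complex.abs_re_le_norm _).trans hvc)
      rw [Complex.sub_re, meshPoint_re, meshPoint_re, ← mul_sub, abs_mul, abs_of_pos hδ]
      rfl
    · refine le_trans ?_ ((Complex.abs_im_le_norm _).trans hvc)
      rw [Complex.sub_im, meshPoint_im, meshPoint_im, ← mul_sub, abs_mul, abs_of_pos hδ]
      rfl
  have hreal : |(v i : ℝ) - (nearestSite δ x i : ℝ)| ≤ n := by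
    have : |(v i : ℝ) - (nearestSite δ x i : ℝ)| ≤ K + 1 := by
      by_contra hlt
      rw [not_le] at hlt
      have := mul_lt_mul_of_pos_left hlt hδ
      linarith
    exact this.trans hK
  have hcast : (((v i - nearestSite δ x i : ℤ) : ℝ)) = (v i : ℝ) - (nearestSite δ x i : ℝ) := by
    push_cast; ring
  have : ((|v i - nearestSite δ x i| : ℤ) : ℝ) ≤ (n : ℝ) := by
    rw [Int.cast_abs, hcast]
    exact hreal
  exact_mod_cast this

/-- **No exploration path traverses a shell many times near a box of controlled corners.** Let
`γ` be an exploration path at mesh `δ > 0` and `ρ < R`. If every medial dart of `γ` whose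
segment meets the ball `B̄(x, ρ)` is carried by a corner whose primal vertex lies in the box of
half-width `n` about `c`, then the polyline of `γ` does not traverse `D(x; ρ, R)`
`8 (2n + 1)² + 3` times: its times in `B̄(x, ρ)` are covered by `4 (2n + 1)² + 1` intervals
(`hasOrdConnectedCover_preimage_polylineFrom`, `segMeetCount_map_le_card` with the dart box,
using that no medial dart is repeated), and `le_of_hasTraversals_of_hasOrdConnectedCover`
applies. (AB99 §1.a "short-distance cutoff", quantitative lattice form.) [cite: AizenmanBurchardDuke1999, §1.a] -/
theorem not_hasTraversals_polyline_of_isMedialExploration {Dd : DiscreteDobrushin}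
    {ω : BondConfig (Site 2)} {γ : List MedialVertex} (hexp : IsMedialExploration Dd ω γ)
    {x : ℂ} {ρ R : ℝ} (hρR : ρ < R) (c : Site 2) (n : ℕ)
    (hbox : ∀ p ∈ γ.zip γ.tail, ∀ v f, IsCorner v f → Dd.IsInnerFace f →
      cornerSource v f = p.1 → cornerTarget v f = p.2 →
      (segment ℝ (medialPoint Dd.δ p.1) (medialPoint Dd.δ p.2) ∩ closedBall x ρ).Nonempty →
      ∀ i, |v i - c i| ≤ n) :
    ¬ (⟨polyline (γ.map (medialPoint Dd.δ))⟩ : RandomPlanarGeometry.Curve ℂ).HasTraversals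
      (2 * ((2 * n + 1) ^ 2 * 4 + 1) + 1) x ρ R := by
  classical
  intro htr
  rcases γ with _ | ⟨a, l⟩
  · exact hexp.ne_nil rfl
  -- the curve is the polyline path from `medialPoint δ a` through `l`
  set mp := medialPoint Dd.δ with hmp
  have hfun : ∀ t, (⟨polyline ((a :: l).map mp)⟩ : RandomPlanarGeometry.Curve ℂ) t = (polylineFrom (mp a) (l.map mp)).2 t :=
    fun t ↦ rfl
  have hcov := hasOrdConnectedCover_preimage_polylineFrom (convex_closedBall x ρ) (mp a) (l.map mp)
  have hpre : (⟨polyline ((a :: l).map mp)⟩ : RandomPlanarGeometry.Curve ℂ) ⁻¹' closedBall x ρ =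
      (polylineFrom (mp a) (l.map mp)).2 ⁻¹' closedBall x ρ := by
    ext t
    rw [mem_preimage, mem_preimage, hfun]
  rw [← hpre] at hcov
  have hcount : segMeetCount (closedBall x ρ) (mp a) (l.map mp) ≤ (dartBox c n).card := by
    refine segMeetCount_map_le_card (closedBall x ρ) mp a l (dartBox c n) hexp.nodup
      fun p hp hmeet ↦ ?_
    obtain ⟨v, f, hvf, hf, hs, ht⟩ := hexp.step p.1 p.2 (infix_of_mem_zip_tail (a :: l) hp)
    have hp' : p = (cornerSource v f, cornerTarget v f) := Prod.ext hs.symm ht.symm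
    rw [hp']
    exact mem_dartBox hvf (hbox p hp v f hvf hf hs ht hmeet)
  have hle := le_of_hasTraversals_of_hasOrdConnectedCover hρR
    (hcov.mono (Nat.add_le_add_right (hcount.trans (card_dartBox_le c n)) 1)) htr
  omega

end MedialGeometry

/-! ### Discharge of (C0) and (Clarge) -/

section Discharge

/-- The exploration polygon is, by definition, the polyline of the exploration vertex list.
(Smirnov 2001, §2.) [cite: Smirnov2001, §2] -/
theorem bondExplorationCurve_eq (D : RandomPlanarGeometry.DobrushinDomain) (δ : ℝ) (ω : BondConfig (Site 2)) :
    bondExplorationCurve D δ ω =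
      ⟨polyline ((medialExploration (dobrushinData D δ) ω).map (medialPoint δ))⟩ :=
  rfl

/-- **(C0) holds**: the short-distance cutoff of the exploration polygon, proved from the
lattice bookkeeping above (`not_hasTraversals_polyline_of_isMedialExploration` with the box of
half-width `5` about the site nearest to the centre of the shell, and
`range_polylineFrom_subset` for the trace). [cite: AizenmanBurchardDuke1999, §1.a] -/
theorem bondExploration_shortDistanceCutoff_holds : bondExploration_shortDistanceCutoff := by
  intro D
  obtain ⟨r, hr⟩ := D.isBounded.subset_closedBall (0 : ℂ)
  refine ⟨max r 0 + 1, 2 * ((2 * 5 + 1) ^ 2 * 4 + 1) + 1, by positivity, fun δ hδ ω ↦ ?_⟩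
  obtain ⟨hδ0, hδ1⟩ := hδ
  rw [bondExplorationCurve_eq]
  rcases medialExploration_eq_nil_or (dobrushinData D δ) ω with hnil | hexp
  · -- junk constant curve `0`
    rw [hnil, List.map_nil, polyline_nil]
    change (RandomPlanarGeometry.Curve.const (0 : ℂ)).range ⊆ _ ∧ ∀ (x : ℂ) (ρ R : ℝ), 0 < ρ → ρ ≤ δ → ρ < R →
      ¬ (RandomPlanarGeometry.Curve.const (0 : ℂ)).HasTraversals _ x ρ R
    refine ⟨?_, fun x ρ R _ _ hρR ↦ RandomPlanarGeometry.Curve.not_hasTraversals_const _ (by omega) hρR⟩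
    rintro _ ⟨t, rfl⟩
    simp only [RandomPlanarGeometry.Curve.const_apply, mem_closedBall, dist_self]
    positivity
  · -- genuine exploration path
    generalize hγ : medialExploration (dobrushinData D δ) ω = γ at hexp
    have hδD : (dobrushinData D δ).δ = δ := rfl
    refine ⟨?_, fun x ρ R hρ hρδ hρR ↦ ?_⟩
    · -- the trace lies within `1` of the domain
      rcases γ with _ | ⟨a, _ | ⟨b, l⟩⟩
      · exact (hexp.ne_nil rfl).elim
      · exact (hexp.head_ne_getLast rfl).elim
      · change Set.range (polylineFrom (medialPoint δ a) ((b :: l).map (medialPoint δ))).2 ⊆ _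
        have hpt : ∀ e ∈ a :: b :: l, medialPoint δ e ∈ closedBall (0 : ℂ) (max r 0 + 1) := by
          intro e he
          obtain ⟨p, hp, hep⟩ := exists_mem_zip_of_mem (a :: b :: l) (by simp) he
          obtain ⟨v, f, hvf, hf, hs, ht⟩ := hexp.step p.1 p.2 (infix_of_mem_zip_tail _ hp)
          have hv : meshPoint δ v ∈ closedBall (0 : ℂ) r :=
            hr (meshPoint_mem_of_isCorner_of_isInnerFace hvf hf)
          have hd : dist (medialPoint δ e) (meshPoint δ v) ≤ δ := by
            rcases hep with rfl | rfl
            · rw [← hs]; exact dist_medialPoint_cornerSource_le hδ0.le hvf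
            · rw [← ht]; exact dist_medialPoint_cornerTarget_le hδ0.le hvf
          rw [mem_closedBall] at hv ⊢
          linarith [dist_triangle (medialPoint δ e) (meshPoint δ v) 0, le_max_left r 0]
        exact range_polylineFrom_subset (convex_closedBall 0 _) (hpt a (by simp))
          fun p hp ↦ by
            obtain ⟨e, he, rfl⟩ := List.mem_map.1 hp
            exact hpt e (List.mem_cons_of_mem _ he)
    · -- no `k₀` traversals of shells of inner radius `ρ ≤ δ`
      refine not_hasTraversals_polyline_of_isMedialExploration hexp hρR (nearestSite δ x) 5
        fun p hp v f hvf hf hs ht hmeet i ↦ ?_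
      refine abs_sub_nearestSite_le (K := 4) hδ0 ?_ (by norm_num) i
      obtain ⟨z, hzseg, hzball⟩ := hmeet
      rw [hδD] at hzseg
      have h1 : dist (medialPoint δ p.1) (meshPoint δ v) ≤ δ := by
        rw [← hs]; exact dist_medialPoint_cornerSource_le hδ0.le hvf
      have h2 : dist (medialPoint δ p.2) (meshPoint δ v) ≤ δ := by
        rw [← ht]; exact dist_medialPoint_cornerTarget_le hδ0.le hvf
      have h12 : dist (medialPoint δ p.2) (medialPoint δ p.1) ≤ 2 * δ := by
        linarith [dist_triangle (medialPoint δ p.2) (meshPoint δ v) (medialPoint δ p.1),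
          dist_comm (meshPoint δ v) (medialPoint δ p.1)]
      have hz : dist z (medialPoint δ p.1) ≤ 2 * δ := by
        have hsub := (convex_closedBall (medialPoint δ p.1) (2 * δ)).segment_subset
          (mem_closedBall_self (by positivity)) (mem_closedBall.2 h12)
        exact mem_closedBall.1 (hsub hzseg)
      rw [mem_closedBall] at hzball
      linarith [dist_triangle (meshPoint δ v) (medialPoint δ p.1) x,
        dist_triangle (medialPoint δ p.1) z x, dist_comm (medialPoint δ p.1) (meshPoint δ v),
        dist_comm z (medialPoint δ p.1)]

/-- The empty family of measures is tight. [folklore] -/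
theorem isTightMeasureSet_empty {X : Type*} [TopologicalSpace X] [MeasurableSpace X] :
    IsTightMeasureSet (∅ : Set (Measure X)) := by
  rw [isTightMeasureSet_iff_exists_isCompact_measure_compl_le]
  exact fun ε _ ↦ ⟨∅, isCompact_empty, fun μ hμ ↦ (Set.notMem_empty μ hμ).elim⟩

/-- **(Clarge) holds**: tightness of the interface laws for meshes `δ ∈ [δ₀, 1]`, by the
Aizenman–Burchard criterion with an *empty* large-scale hypothesis: at mesh `δ ≥ δ₀` every
corner of an inner face lies in a fixed box, so by `not_hasTraversals_polyline_of_isMedialExploration`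
no exploration polygon traverses any shell more than a fixed number `K₁` of times, and with the
threshold `max k₀ K₁` the events in (H1) are empty while (H0) is (C0).
[cite: AizenmanBurchardDuke1999, §1.a] -/
theorem isTightMeasureSet_map_bondInterface_of_le_holds :
    isTightMeasureSet_map_bondInterface_of_le := by
  intro D δ₀ hδ₀
  by_cases hδ₀1 : 1 < δ₀
  · rw [Set.Icc_eq_empty (not_le.2 hδ₀1), Set.image_empty]
    exact isTightMeasureSet_empty
  rw [not_lt] at hδ₀1
  obtain ⟨r₀, k₀, hr₀, hcut⟩ := bondExploration_shortDistanceCutoff_holds D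
  obtain ⟨r, hr⟩ := D.isBounded.subset_closedBall (0 : ℂ)
  set N : ℕ := ⌈max r 0 / δ₀⌉₊ + 1 with hN
  set K₁ : ℕ := 2 * ((2 * N + 1) ^ 2 * 4 + 1) + 1 with hK₁
  have hT : Set.Icc δ₀ 1 ⊆ Set.Ioc (0 : ℝ) 1 := fun δ hδ ↦ ⟨hδ₀.trans_le hδ.1, hδ.2⟩
  -- no polygon of mesh `δ ≥ δ₀` traverses any shell `K₁` times
  have hnone : ∀ δ ∈ Set.Icc δ₀ 1, ∀ (ω : BondConfig (Site 2)) (x : ℂ) (ρ R : ℝ), ρ < R →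
      ¬ (bondExplorationCurve D δ ω).HasTraversals K₁ x ρ R := by
    intro δ hδ ω x ρ R hρR
    have hδ0 : 0 < δ := hδ₀.trans_le hδ.1
    rw [bondExplorationCurve_eq]
    rcases medialExploration_eq_nil_or (dobrushinData D δ) ω with hnil | hexp
    · rw [hnil, List.map_nil, polyline_nil]
      exact RandomPlanarGeometry.Curve.not_hasTraversals_const _ (by omega) hρR
    · refine not_hasTraversals_polyline_of_isMedialExploration hexp hρR 0 N
        fun p hp v f hvf hf _ _ _ i ↦ ?_
      have hv : meshPoint δ v ∈ closedBall (0 : ℂ) r :=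
        hr (meshPoint_mem_of_isCorner_of_isInnerFace hvf hf)
      have hK : dist (meshPoint δ v) 0 ≤ (max r 0 / δ) * δ := by
        rw [div_mul_cancel₀ _ hδ0.ne']
        exact (mem_closedBall.1 hv).trans (le_max_left _ _)
      have h0 : nearestSite δ 0 = 0 := by
        ext j; fin_cases j <;> simp [nearestSite]
      have := abs_sub_nearestSite_le (n := N) hδ0 hK ?_ i
      · simpa [h0] using this
      · have h1 : max r 0 / δ ≤ max r 0 / δ₀ :=
          div_le_div_of_nonneg_left (le_max_right _ _) hδ₀ hδ.1
        have h2 : max r 0 / δ₀ ≤ ⌈max r 0 / δ₀⌉₊ := Nat.le_ceil _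
        simp only [hN, Nat.cast_add, Nat.cast_one]
        linarith
  have key := RandomPlanarGeometry.isTightMeasureSet_of_traversalBounds (E := ℂ) (isCompact_closedBall (0 : ℂ) r₀)
    (C := 9 * (r₀ + 2) ^ 2) (d := 2) zero_le_two
    (fun ρ hρ hρ1 ↦ RandomPlanarGeometry.exists_finset_card_le_cover_closedBall hr₀ ρ hρ hρ1)
    (Ω := fun _ ↦ BondConfig (Site 2)) (fun _ ↦ bondPercolation (zdGraph 2) half)
    (fun δ ω ↦ orientCurve D (medialExplorationCurve (dobrushinData D δ) ω))
    (fun _ _ _ ↦ max k₀ K₁) (K := 0) (lam := 3) le_rfl (by norm_num) hT ?_ ?_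
  · simpa only [bondInterface_eq_comp] using key
  · -- (H0) from (C0)
    intro δ hδ
    refine ae_of_all _ fun ω ↦ ⟨?_, fun x ρ R hρ hρδ hρR htr ↦ ?_⟩
    · rw [curveRange_orientCurve]
      exact (hcut δ (hT hδ) ω).1
    · rw [hasTraversals_orientCurve_iff] at htr
      exact (hcut δ (hT hδ) ω).2 x ρ R hρ hρδ hρR (htr.of_le (le_max_left _ _))
  · -- (H1): the events are empty
    intro δ hδ x ρ R _ hρR _
    have hempty : {ω | (orientCurve D (medialExplorationCurve (dobrushinData D δ) ω)).HasTraversals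
        (max k₀ K₁) x ρ R} = ∅ := by
      refine Set.subset_empty_iff.1 fun ω hω ↦ ?_
      rw [mem_setOf_eq, hasTraversals_orientCurve_iff] at hω
      exact hnone δ hδ ω x ρ R hρR (hω.of_le (le_max_right _ _))
    rw [hempty, measure_empty]
    exact bot_le

end Discharge

/-- **crit-perc.S26, bond case, reduced to the single percolation estimate (C1).** With (C0)
and (Clarge) proved above, the tightness statement `isTightLaws_map_bondInterface` follows from
the traversal bound `bondExploration_traversalBound` alone. (Aizenman–Burchard 1999, Thm 1.2
with Appendix A.) [cite: AizenmanBurchardDuke1999, Thm 1.2] -/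
theorem isTightLaws_map_bondInterface_of_traversalBound (h1 : bondExploration_traversalBound) :
    isTightLaws_map_bondInterface :=
  isTightLaws_map_bondInterface_of_traversalBounds bondExploration_shortDistanceCutoff_holds h1
    isTightMeasureSet_map_bondInterface_of_le_holds

end CritPerc

end Literature.Probability.Percolation
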